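import Summits.RiemannHypothesis.RiemannHypothesis.Theorems.PfPersistenceDilatingLandauWeightedDictionary
import Summits.RiemannHypothesis.RiemannHypothesis.Theorems.PfPersistenceDilatingLandauWeightedAbel
import Summits.RiemannHypothesis.RiemannHypothesis.Theorems.PfPersistenceDilatingLandau
import HarnessLib

/-!
# LANDAU for `S(x) = Σ_{n ≤ x} Λ(n)/√n` — V: the converse under RH and the `ε`-equivalences

Cell `pub-rhpf` (mechanism/rigidity campaign; **no RH claims**), CAND SEAT 7 gen 8, CASE-DAG v6 §6
kernel target LANDAU, weighted statistic, file 5: the RH ⇒ side. By Abel summation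
`S(x) = x^{-1/2} ψ(x) + ½ ∫_1^x t^{-3/2} ψ(t) dt` (file IV, `wpsi_eq_abel`), so von Koch's
`ψ(x) − x = O(x^{1/2+δ})` (tree, via `PfPersistenceDilatingLandau.abs_psi_sub_le_rpow_of_riemannHypothesis`)
gives, under RH, `|S(x) − 2√x| ≤ x^ε` for all large `x`, every `ε > 0`
(`abs_wpsiErr_le_rpow_of_riemannHypothesis`). With file 3 this yields the ONE-SIDED
`ε`-EQUIVALENCES `riemannHypothesis_iff_wpsi_upper_eps` / `riemannHypothesis_iff_wpsi_lower_eps`: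
RH ⟺ (∀ ε > 0, `S(x) − 2√x ≤ x^ε` eventually) ⟺ (∀ ε > 0, `−x^ε ≤ S(x) − 2√x` eventually), the exact
weighted analogue of `PfPersistenceDilatingLandau.riemannHypothesis_iff_psi_upper_eps` (threshold
scale `x^0` instead of `x^{1/2}`). Sorry-free; the RH-free direction is file 3.

References: [MontgomeryVaughan2007] Montgomery–Vaughan, *Multiplicative Number Theory I*, Thm. 13.1,
§15.1; Abel summation (Mathlib `sum_mul_eq_sub_integral_mul₀`).
-/

noncomputable section

-- the sub-problem path RiemannHypothesis/RiemannHypothesis duplicates a namespace (D-0017)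
set_option linter.dupNamespace false

open Filter Topology Set MeasureTheory

namespace Summit.RiemannHypothesis.RiemannHypothesis.Theorems.PfPersistenceDilatingLandauWeightedConverse

open Literature.NumberTheory.LFunctions
open Summit.RiemannHypothesis.RiemannHypothesis.Theorems.PfPersistenceDilatingLandauWeightedMellin
open Summit.RiemannHypothesis.RiemannHypothesis.Theorems.PfPersistenceDilatingLandauWeightedDictionary
open Summit.RiemannHypothesis.RiemannHypothesis.Theorems.PfPersistenceDilatingLandauWeightedAbel
open Summit.RiemannHypothesis.RiemannHypothesis.Theorems.PfPersistenceDilatingLandau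

/-! ## §7 RH ⇒ `S(x) − 2√x = O(x^ε)` -/

/-- **Under RH, `|S(x) − 2√x| ≤ x^ε` for all large `x`, for every `ε > 0`** (Abel summation from
von Koch's bound for `ψ`). [cite: MontgomeryVaughan2007, Thm. 13.1] -/
theorem abs_wpsiErr_le_rpow_of_riemannHypothesis (hRH : RiemannHypothesis) {ε : ℝ} (hε : 0 < ε) :
    ∀ᶠ x in atTop, |wpsiErr x| ≤ x ^ ε := by
  have hδ : 0 < ε / 2 := by linarith
  obtain ⟨T₀, hT₀⟩ := eventually_atTop.1 (abs_psi_sub_le_rpow_of_riemannHypothesis hRH hδ)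
  set T : ℝ := max T₀ 1 with hTdef
  have hT1 : 1 ≤ T := le_max_right _ _
  have hE : ∀ t, T ≤ t → |Chebyshev.psi t - t| ≤ t ^ (1 / 2 + ε / 2) := fun t ht ↦
    hT₀ t ((le_max_left _ _).trans ht)
  set M : ℝ := Chebyshev.psi T + T with hMdef
  have hM0 : 0 ≤ M := by have := Chebyshev.psi_nonneg T; positivity
  -- pointwise bound `t^{-3/2} |ψ(t) − t| ≤ M t^{-3/2} + t^{-1+ε/2}` on `(1, ∞)`
  have hpt : ∀ t : ℝ, 1 < t →
      |t ^ (-(3 / 2 : ℝ)) * (Chebyshev.psi t - t)| ≤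
        M * t ^ (-(3 / 2 : ℝ)) + t ^ (-1 + ε / 2) := by
    intro t ht
    have ht0 : 0 < t := by linarith
    have hp : 0 < t ^ (-(3 / 2 : ℝ)) := Real.rpow_pos_of_pos ht0 _
    have hq : 0 < t ^ (-1 + ε / 2) := Real.rpow_pos_of_pos ht0 _
    rw [abs_mul, abs_of_pos hp]
    rcases le_or_gt T t with hTt | htT
    · have h1 : t ^ (-(3 / 2 : ℝ)) * |Chebyshev.psi t - t| ≤ t ^ (-1 + ε / 2) := by
        calc t ^ (-(3 / 2 : ℝ)) * |Chebyshev.psi t - t|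
            ≤ t ^ (-(3 / 2 : ℝ)) * t ^ (1 / 2 + ε / 2) := mul_le_mul_of_nonneg_left (hE t hTt) hp.le
          _ = t ^ (-1 + ε / 2) := by
              rw [← Real.rpow_add ht0]; congr 1; ring
      nlinarith [mul_nonneg hM0 hp.le]
    · have h2 : |Chebyshev.psi t - t| ≤ M := by
        have hψt : Chebyshev.psi t ≤ Chebyshev.psi T := Chebyshev.psi_mono htT.le
        have hψ0 := Chebyshev.psi_nonneg t
        rw [abs_le]; constructor <;> linarith
      have h1 : t ^ (-(3 / 2 : ℝ)) * |Chebyshev.psi t - t| ≤ M * t ^ (-(3 / 2 : ℝ)) := by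
        rw [mul_comm M]; exact mul_le_mul_of_nonneg_left h2 hp.le
      linarith
  -- the threshold in `x`
  have hy : Tendsto (fun x : ℝ ↦ x ^ (ε / 2)) atTop atTop := tendsto_rpow_atTop hδ
  filter_upwards [eventually_ge_atTop T, hy.eventually_ge_atTop (2 * (1 + 1 / ε)),
    hy.eventually_ge_atTop (2 * (M + 1)), hy.eventually_ge_atTop 1] with x hxT hy1 hy2 hy3
  have hx1 : 1 ≤ x := hT1.trans hxT
  have hx0 : 0 < x := by linarith
  -- integrability facts on `(1, x]`
  have hψbdd : ∀ t ∈ Ioc 1 x, |Chebyshev.psi t| ≤ Chebyshev.psi x := fun t ht ↦ by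
    rw [abs_of_nonneg (Chebyshev.psi_nonneg t)]; exact Chebyshev.psi_mono ht.2
  have hEbdd : ∀ t ∈ Ioc 1 x, |Chebyshev.psi t - t| ≤ Chebyshev.psi x + x := fun t ht ↦ by
    have hψt : Chebyshev.psi t ≤ Chebyshev.psi x := Chebyshev.psi_mono ht.2
    have hψ0 := Chebyshev.psi_nonneg t
    rw [abs_le]; constructor <;> linarith [ht.1, ht.2]
  have hIψ : IntegrableOn (fun t : ℝ ↦ t ^ (-(3 / 2 : ℝ)) * Chebyshev.psi t) (Ioc 1 x) :=
    integrableOn_rpow_mul_of_bdd Nicolas.measurable_psi hψbdd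
  have hIE : IntegrableOn (fun t : ℝ ↦ t ^ (-(3 / 2 : ℝ)) * (Chebyshev.psi t - t)) (Ioc 1 x) :=
    integrableOn_rpow_mul_of_bdd (Nicolas.measurable_psi.sub measurable_id') hEbdd
  have hidbdd : ∀ t ∈ Ioc 1 x, |(fun u : ℝ ↦ u) t| ≤ x := fun t ht ↦ by
    have h1 : (0 : ℝ) < t := by linarith [ht.1]
    simp only [abs_of_pos h1]
    exact ht.2
  have hIid : IntegrableOn (fun t : ℝ ↦ t ^ (-(3 / 2 : ℝ)) * t) (Ioc 1 x) :=
    integrableOn_rpow_mul_of_bdd (g := fun u : ℝ ↦ u) measurable_id' hidbdd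
  have hcpow : ∀ a : ℝ, ContinuousOn (fun t : ℝ ↦ t ^ a) (Set.Icc 1 x) := fun a ↦
    ContinuousOn.rpow_const (by fun_prop) fun t ht ↦ Or.inl (by linarith [ht.1] : t ≠ 0)
  have hIpow : ∀ a : ℝ, IntegrableOn (fun t : ℝ ↦ t ^ a) (Ioc 1 x) := fun a ↦
    (hcpow a).integrableOn_Icc.mono_set Ioc_subset_Icc_self
  have h0uIcc : (0 : ℝ) ∉ Set.uIcc 1 x := by
    rw [Set.uIcc_of_le hx1]; intro h; linarith [h.1]
  -- `∫_{(1,x]} t^{-3/2} · t dt = 2√x − 2`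
  have hmain : ∫ t in Ioc 1 x, t ^ (-(3 / 2 : ℝ)) * t = 2 * x ^ (1 / 2 : ℝ) - 2 := by
    have h1 : ∫ t in Ioc 1 x, t ^ (-(3 / 2 : ℝ)) * t = ∫ t in Ioc 1 x, t ^ (-(1 / 2 : ℝ)) := by
      refine setIntegral_congr_fun measurableSet_Ioc fun t ht ↦ ?_
      have ht0 : 0 < t := by linarith [ht.1]
      calc t ^ (-(3 / 2 : ℝ)) * t = t ^ (-(3 / 2 : ℝ)) * t ^ (1 : ℝ) := by rw [Real.rpow_one]
        _ = t ^ (-(1 / 2 : ℝ)) := by rw [← Real.rpow_add ht0]; norm_num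
    rw [h1, ← intervalIntegral.integral_of_le hx1, integral_rpow (Or.inr ⟨by norm_num, h0uIcc⟩)]
    rw [Real.one_rpow]
    norm_num
    ring
  -- `∫_{(1,x]} (M t^{-3/2} + t^{-1+ε/2}) dt ≤ 2M + (2/ε) x^{ε/2}`
  have hdom : ∫ t in Ioc 1 x, (M * t ^ (-(3 / 2 : ℝ)) + t ^ (-1 + ε / 2)) ≤
      2 * M + 2 / ε * x ^ (ε / 2) := by
    rw [integral_add ((hIpow _).const_mul M) (hIpow _), integral_const_mul,
      ← intervalIntegral.integral_of_le hx1, ← intervalIntegral.integral_of_le hx1,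
      integral_rpow (Or.inr ⟨by norm_num, h0uIcc⟩), integral_rpow (Or.inl (by linarith)),
      Real.one_rpow, Real.one_rpow]
    have e1 : (-(3 / 2 : ℝ)) + 1 = -(1 / 2 : ℝ) := by norm_num
    have e2 : (-1 + ε / 2) + 1 = ε / 2 := by ring
    rw [e1, e2]
    have hxm : 0 ≤ x ^ (-(1 / 2 : ℝ)) := Real.rpow_nonneg hx0.le _
    have hA : M * ((x ^ (-(1 / 2 : ℝ)) - 1) / (-(1 / 2 : ℝ))) ≤ 2 * M := by
      have : (x ^ (-(1 / 2 : ℝ)) - 1) / (-(1 / 2 : ℝ)) = 2 - 2 * x ^ (-(1 / 2 : ℝ)) := by ring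
      rw [this]; nlinarith
    have hB : (x ^ (ε / 2) - 1) / (ε / 2) ≤ 2 / ε * x ^ (ε / 2) := by
      rw [div_le_iff₀ hδ]
      have : 2 / ε * x ^ (ε / 2) * (ε / 2) = x ^ (ε / 2) := by field_simp
      rw [this]; linarith
    linarith
  -- the error integral
  have herr : |∫ t in Ioc 1 x, t ^ (-(3 / 2 : ℝ)) * (Chebyshev.psi t - t)| ≤
      2 * M + 2 / ε * x ^ (ε / 2) := by
    refine le_trans ?_ hdom
    have h := norm_integral_le_of_norm_le (μ := volume.restrict (Ioc 1 x))
      (f := fun t : ℝ ↦ t ^ (-(3 / 2 : ℝ)) * (Chebyshev.psi t - t))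
      (g := fun t : ℝ ↦ M * t ^ (-(3 / 2 : ℝ)) + t ^ (-1 + ε / 2))
      (((hIpow _).const_mul M).add (hIpow _))
      ((ae_restrict_iff' measurableSet_Ioc).2 (Eventually.of_forall fun t ht ↦ by
        rw [Real.norm_eq_abs]; exact hpt t ht.1))
    simpa only [Real.norm_eq_abs] using h
  -- assemble: `S(x) − 2√x = x^{-1/2}(ψ(x) − x) + ½∫ t^{-3/2}(ψ − t) − 1`
  have hsplit : ∫ t in Ioc 1 x, t ^ (-(3 / 2 : ℝ)) * Chebyshev.psi t =
      (∫ t in Ioc 1 x, t ^ (-(3 / 2 : ℝ)) * (Chebyshev.psi t - t)) +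
        ∫ t in Ioc 1 x, t ^ (-(3 / 2 : ℝ)) * t := by
    rw [← integral_add hIE hIid]
    refine setIntegral_congr_fun measurableSet_Ioc fun t _ ↦ ?_
    ring
  have hxhalf : x ^ (-(1 / 2 : ℝ)) * x = x ^ (1 / 2 : ℝ) := by
    calc x ^ (-(1 / 2 : ℝ)) * x = x ^ (-(1 / 2 : ℝ)) * x ^ (1 : ℝ) := by rw [Real.rpow_one]
      _ = x ^ (1 / 2 : ℝ) := by rw [← Real.rpow_add hx0]; norm_num
  have hrepr : wpsiErr x = x ^ (-(1 / 2 : ℝ)) * (Chebyshev.psi x - x) +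
      1 / 2 * (∫ t in Ioc 1 x, t ^ (-(3 / 2 : ℝ)) * (Chebyshev.psi t - t)) - 1 := by
    rw [wpsiErr, wpsi_eq_abel x, hsplit, hmain, mul_sub, hxhalf]
    ring
  -- the head term
  have hhead : |x ^ (-(1 / 2 : ℝ)) * (Chebyshev.psi x - x)| ≤ x ^ (ε / 2) := by
    have hp : 0 < x ^ (-(1 / 2 : ℝ)) := Real.rpow_pos_of_pos hx0 _
    rw [abs_mul, abs_of_pos hp]
    calc x ^ (-(1 / 2 : ℝ)) * |Chebyshev.psi x - x|
        ≤ x ^ (-(1 / 2 : ℝ)) * x ^ (1 / 2 + ε / 2) := mul_le_mul_of_nonneg_left (hE x hxT) hp.le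
      _ = x ^ (ε / 2) := by rw [← Real.rpow_add hx0]; congr 1; ring
  -- conclusion
  have hsq : x ^ ε = x ^ (ε / 2) * x ^ (ε / 2) := by rw [← Real.rpow_add hx0]; ring_nf
  rw [hrepr, hsq]
  set y : ℝ := x ^ (ε / 2) with hydef
  set a : ℝ := x ^ (-(1 / 2 : ℝ)) * (Chebyshev.psi x - x) with hadef
  set I : ℝ := ∫ t in Ioc 1 x, t ^ (-(3 / 2 : ℝ)) * (Chebyshev.psi t - t) with hIdef
  have hmid : |1 / 2 * I| ≤ 1 / 2 * (2 * M + 2 / ε * y) := by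
    rw [abs_mul, abs_of_pos (by norm_num : (0 : ℝ) < 1 / 2)]
    exact mul_le_mul_of_nonneg_left herr (by norm_num)
  have h3 : |a + 1 / 2 * I - 1| ≤ |a| + |1 / 2 * I| + |(-1 : ℝ)| := by
    rw [sub_eq_add_neg]
    exact abs_add_three a (1 / 2 * I) (-1)
  rw [abs_neg, abs_one] at h3
  have hy0 : 0 ≤ y := by positivity
  have hε' : 0 ≤ 1 / ε := by positivity
  have h1' : (1 + 1 / ε) * y ≤ y * y / 2 := by nlinarith
  have h2' : M + 1 ≤ y * y / 2 := by nlinarith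
  calc |a + 1 / 2 * I - 1| ≤ |a| + |1 / 2 * I| + 1 := h3
    _ ≤ y + 1 / 2 * (2 * M + 2 / ε * y) + 1 := by linarith
    _ = (1 + 1 / ε) * y + (M + 1) := by ring
    _ ≤ y * y := by linarith

/-! ## §8 The one-sided `ε`-equivalences for `S` -/

/-- **One-sided `x^ε` bounds for every `ε > 0` ⇒ RH** (either sign). [cite: MontgomeryVaughan2007, Thm. 15.3 (shifted)] -/
theorem riemannHypothesis_of_wpsi_oneSided_eps {η : ℝ} (hη : η = 1 ∨ η = -1)
    (h : ∀ ε : ℝ, 0 < ε → ∀ᶠ x in atTop, η * wpsiErr x ≤ x ^ ε) : RiemannHypothesis := by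
  refine quasiRiemannHypothesis_one_half_iff_holds.mp fun s hs h1 _h2 ↦ ?_
  have hε : 0 < (s.re - 1 / 2) / 2 := by linarith
  have hev : ∀ᶠ x in atTop, η * wpsiErr x ≤ 1 * x ^ ((s.re - 1 / 2) / 2) := by
    simpa only [one_mul] using h _ hε
  have := re_le_of_wpsi_oneSided hη hε.le hev hs
  linarith

/-- **RH ⟺ (∀ ε > 0, `S(x) − 2√x ≤ x^ε` for all large `x`).**
[cite: MontgomeryVaughan2007, Thm. 13.1, Thm. 15.3 (shifted)] -/
theorem riemannHypothesis_iff_wpsi_upper_eps :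
    RiemannHypothesis ↔ ∀ ε : ℝ, 0 < ε → ∀ᶠ x in atTop, wpsiErr x ≤ x ^ ε := by
  constructor
  · intro hRH ε hε
    filter_upwards [abs_wpsiErr_le_rpow_of_riemannHypothesis hRH hε] with x hx
    exact (le_abs_self _).trans hx
  · intro h
    refine riemannHypothesis_of_wpsi_oneSided_eps (η := 1) (Or.inl rfl) fun ε hε ↦ ?_
    filter_upwards [h ε hε] with x hx
    rwa [one_mul]

/-- **RH ⟺ (∀ ε > 0, `−x^ε ≤ S(x) − 2√x` for all large `x`).**
[cite: MontgomeryVaughan2007, Thm. 13.1, Thm. 15.3 (shifted)] -/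
theorem riemannHypothesis_iff_wpsi_lower_eps :
    RiemannHypothesis ↔ ∀ ε : ℝ, 0 < ε → ∀ᶠ x in atTop, -x ^ ε ≤ wpsiErr x := by
  constructor
  · intro hRH ε hε
    filter_upwards [abs_wpsiErr_le_rpow_of_riemannHypothesis hRH hε] with x hx
    exact (abs_le.1 hx).1
  · intro h
    refine riemannHypothesis_of_wpsi_oneSided_eps (η := -1) (Or.inr rfl) fun ε hε ↦ ?_
    filter_upwards [h ε hε] with x hx
    linarith

/-- **The trichotomy for one-sided power-scale readers of `S(x) − 2√x`** (`η = ±1`):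
(a) for every `τ ≥ 0`, `η(S − 2√x) ≤ A x^τ` eventually ⇒ quasi-RH(1/2 + τ);
(b) RH ⟺ (∀ ε > 0, `η(S − 2√x) ≤ x^ε` eventually);
(c) `τ = 0`: a one-sided `O(1)` bound ⇒ RH.
[cite: MontgomeryVaughan2007, Thm. 13.1, Thm. 15.3 (shifted)] -/
theorem wpsi_oneSided_trichotomy {η : ℝ} (hη : η = 1 ∨ η = -1) :
    (∀ A τ : ℝ, 0 ≤ τ → (∀ᶠ x in atTop, η * wpsiErr x ≤ A * x ^ τ) →
        QuasiRiemannHypothesis (1 / 2 + τ)) ∧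
      (RiemannHypothesis ↔ ∀ ε : ℝ, 0 < ε → ∀ᶠ x in atTop, η * wpsiErr x ≤ x ^ ε) ∧
      (∀ A : ℝ, (∀ᶠ x in atTop, η * wpsiErr x ≤ A) → RiemannHypothesis) := by
  refine ⟨fun A τ hτ hev ↦ quasiRiemannHypothesis_of_wpsi_oneSided hη hτ hev, ?_,
    fun A hev ↦ riemannHypothesis_of_wpsi_oneSided_bdd hη hev⟩
  constructor
  · intro hRH ε hε
    filter_upwards [abs_wpsiErr_le_rpow_of_riemannHypothesis hRH hε] with x hx
    rcases hη with rfl | rfl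
    · rw [one_mul]; exact (le_abs_self _).trans hx
    · have := (abs_le.1 hx).1; linarith
  · exact riemannHypothesis_of_wpsi_oneSided_eps hη

end Summit.RiemannHypothesis.RiemannHypothesis.Theorems.PfPersistenceDilatingLandauWeightedConverse

end
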